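import Summits.CriticalPhenomena.PercolationContinuityZ3.Theorems.PercNearOneGluingNoHeavyQuantGatedSliceMixLawPooled
import HarnessLib

/-!
# QUANT lane R8, T-DEC, leg (III), blob case — the kink member (I_{U₁}) of the moved two-point law (cell P-DEAR of regime B):
# the twin-gap usage bound `B₁ ≥ 0`, the mean-identity form (♥), and (I_{U₁}) on all of the cell but one thin regime

builds on p205010 (kernel theorem, internal audit signed; external expert review pending)

Support file (`--supports stmt-CriticalPhenomena-4575`), QUANT lane seat prim-quant-arm-2 (gen 36), rung R8 of
`run/shared/lean/prim/quant/LADDER.md`.  Theorems only, standard axioms, no sorries, no definitions.  Consumer: `…QuantGatedSliceMixLawPCells`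
(`decAtT_movedTwoPoint_PDear_of_kink` takes (I_{U₁}) as its one hypothesis).  Tools: census-2 g61's `pooled_dear` (`…Pooled`), the usage
closed forms `usage_eq_heavy'` / `usage_eq_light'` (`…LightTwoBlobFlow`).

SETTING (`…PRoutings`): `P = z·δ₀ + m₁δ_{k₁} + m₁'δ_ℓ + m₂δ_{k₂} + m₂'δ_{k₂+a}`, `ℓ = k₁+a` and `k₁` `t`-lows compatible with the mid
`k₂ ≤ j`, `k₂ + a` a giant, `u = y/(1−y)`, `U₁ = usage(k₁,k₂)`, `U_d = usage(ℓ,k₂)`; `k₁` DEAR at `k₂` (`y(k₂−k₁) ≤ t−2k₁`, so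
`U₁ = (t−2k₁)/(k₁+k₂−t) ≥ u`).  THE KINK MEMBER  (I_{U₁}) `U₁(z + m₁) + U_d m₁' ≤ m₂ + (U₁/u)·m₂'`.

* `LawDec.usage_twin_gap` — **`B₁ ≥ 0`**: `U_d·(k₂ − t + k₁) ≤ t − ℓ`, i.e. the minimal gate of `(ℓ, k₂)` is at most the balanced gate
  `(t−ℓ)/(k₂−a)` of the pair `(ℓ, k₂+k₁)` — dear `ℓ`: `(t−ℓ)(ℓ+k₂−t) − (t−2ℓ)(k₂−t+k₁) = a(k₂−ℓ) + k₁(ℓ+k₂−t) ≥ 0`; light `ℓ`: the light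
  numerator is increasing in `y ≤ ρ₁ = (t−2k₁)/(k₂−k₁)` and at `ρ₁` the slack is `(k₁+k₂−t)[k₁(k₂−k₁)² + a(k₂−a)(k₁+k₂−t)] ≥ 0`.
* **`LawDec.kink_member_U1`** — (I_{U₁}) from the cell frame, PROVIDED it holds in the thin regime
  `{u z < m₂' < u(z + m₁)} ∩ {(t−2k₁)/u < k₂ + a − t}` (taken as a hypothesis; seat census 14 000 / 0 there, sufficient closed-form
  inequality SC of lane INBOX l.1100+ 8 000 / 0).  Proof: if `u(z+m₁) ≤ m₂'`, `pooled_dear` and `U₁ ≥ u`; otherwise the mean identity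
  `t·z = (k₂−t)m₂ + (k₂+a−t)m₂' − (t−k₁)m₁ − (t−ℓ)m₁'` turns (I_{U₁})·(k₁+k₂−t) into
  (♥) `2k₁z + k₁m₁ + k₁m₂ + B₁m₁' ≥ B₂m₂'`, `B₂ = (k₂+a−t) − (t−2k₁)/u`, which is immediate when `B₂ ≤ 0` and, when `m₂' ≤ u z`, from
  `B₂·u ≤ 2k₁` (`u(k₂+a−t) ≤ t` by `y(k₂+a) ≤ t`).
HONEST STATUS: (I_{U₁}) in the thin regime OPEN (census only); `MixLawCellPDear` open modulo it; `MixLawRegimeB`, `GatedSliceMixLaw'`, CW,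
`SingleGateConvClosed`, `TreeDEC`, `FarTreeRow` OPEN; RATE class log* / honest sentence unchanged.

[this work]; pooled inequality: census-2 g61; usage closed forms: prim-quant-stmt / census-2 (this lane).  Nothing here is cited as a
published result.  The gluing rows served [cite: KozmaNitzan2024, Conjecture 3 (p. 15)]; product measure [cite: Grimmett1999, §1.3 p. 10].
-/

noncomputable section

namespace Summit.CriticalPhenomena.PercolationContinuityZ3.Theorems

namespace Quant

open Finset

namespace LawDec

/-! ### `B₁ ≥ 0`: the twin-gap usage bound -/

set_option maxHeartbeats 400000 in
/-- **`B₁ ≥ 0`**: for `t`-lows `k₁`, `ℓ = k₁ + a` compatible with the mid `k₂ ≤ j` (`t < k₁ + k₂`, `t ≤ 2k₂`) and `k₁` dear at `k₂`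
(`y(k₂ − k₁) ≤ t − 2k₁`): `usage(ℓ,k₂)·(k₂ − t + k₁) ≤ t − ℓ`. [this work] -/
theorem usage_twin_gap (y t : ℝ) (j a k₁ k₂ : ℕ) (hy0 : 0 < y) (hy1 : y < 1) (hk₂j : k₂ ≤ j)
    (hk₁low : 2 * (k₁ : ℝ) < t) (hPlow : 2 * ((k₁ + a : ℕ) : ℝ) < t) (hk₂mid : t ≤ 2 * (k₂ : ℝ))
    (hcomp : t < ((k₁ + a : ℕ) : ℝ) + k₂) (hc1 : t < (k₁ : ℝ) + k₂)
    (hdear : y * ((k₂ : ℝ) - k₁) ≤ t - 2 * (k₁ : ℝ)) :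
    usage y t j (k₁ + a) k₂ * ((k₂ : ℝ) - t + k₁) ≤ t - ((k₁ + a : ℕ) : ℝ) := by
  have hdcast : ((k₁ + a : ℕ) : ℝ) = (k₁ : ℝ) + a := by push_cast; ring
  have ha0 : (0 : ℝ) ≤ a := Nat.cast_nonneg a
  have hk₁0 : (0 : ℝ) ≤ k₁ := Nat.cast_nonneg k₁
  have h1y : 0 < 1 - y := by linarith
  have hd : (0 : ℝ) < (k₂ : ℝ) - ((k₁ : ℝ) + a) := by rw [hdcast] at hPlow; linarith
  have hden : (0 : ℝ) < (k₂ : ℝ) - t + k₁ := by linarith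
  by_cases hρ : y * ((k₂ : ℝ) - ((k₁ + a : ℕ) : ℝ)) ≤ t - 2 * ((k₁ + a : ℕ) : ℝ)
  · -- dear ℓ: U_d = (t − 2ℓ)/(ℓ + k₂ − t)
    rw [usage_eq_heavy' y t j (k₁ + a) k₂ hy0 hy1 hk₂j hPlow hcomp hρ, hdcast, div_mul_eq_mul_div,
      div_le_iff₀ (by rw [hdcast] at hcomp; linarith)]
    -- (t−ℓ)(ℓ+k₂−t) − (t−2ℓ)(k₂−t+k₁) = a(k₂−ℓ) + k₁(ℓ+k₂−t)
    have hc' : 0 < ((k₁ : ℝ) + a) + k₂ - t := by rw [hdcast] at hcomp; linarith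
    nlinarith [mul_nonneg ha0 hd.le, mul_nonneg hk₁0 hc'.le, hdcast]
  · -- light ℓ
    have hρ' : t - 2 * ((k₁ + a : ℕ) : ℝ) ≤ y * ((k₂ : ℝ) - ((k₁ + a : ℕ) : ℝ)) := (not_le.1 hρ).le
    rw [usage_eq_light' y t j (k₁ + a) k₂ hy0 hy1 hk₂j hPlow hcomp hρ', hdcast]
    rw [hdcast] at hρ' hcomp hPlow
    have hDn : 0 < (1 - y) * ((1 - y) * ((k₁ : ℝ) + a) + (1 + y) * k₂ - t) := by
      apply mul_pos h1y; nlinarith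
    rw [div_mul_eq_mul_div, div_le_iff₀ hDn]
    -- N := y²(k₂−ℓ) + (1−y)(t−2ℓ);  Dn = (k₂−ℓ) − N;  goal ⟸ N(k₂−a) ≤ (t−ℓ)(k₂−ℓ)
    set N : ℝ := y ^ 2 * ((k₂ : ℝ) - ((k₁ : ℝ) + a)) + (1 - y) * (t - 2 * ((k₁ : ℝ) + a)) with hN
    have eDn : (1 - y) * ((1 - y) * ((k₁ : ℝ) + a) + (1 + y) * k₂ - t) = ((k₂ : ℝ) - ((k₁ : ℝ) + a)) - N := by
      rw [hN]; ring
    -- monotonicity in y ≤ ρ₁: with Y := y(k₂−k₁) ≤ t − 2k₁,  N(k₂−k₁)² ≤ f(t−2k₁)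
    have hK : (0 : ℝ) < (k₂ : ℝ) - k₁ := by linarith
    set Y : ℝ := y * ((k₂ : ℝ) - k₁) with hY
    have hYle : Y ≤ t - 2 * (k₁ : ℝ) := hdear
    have hYlight : (t - 2 * ((k₁ : ℝ) + a)) * ((k₂ : ℝ) - k₁) ≤ Y * ((k₂ : ℝ) - ((k₁ : ℝ) + a)) := by
      rw [hY]; nlinarith
    have eNK : N * ((k₂ : ℝ) - k₁) ^ 2
        = Y ^ 2 * ((k₂ : ℝ) - ((k₁ : ℝ) + a)) + ((k₂ : ℝ) - k₁) * (((k₂ : ℝ) - k₁) - Y) * (t - 2 * ((k₁ : ℝ) + a)) := by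
      rw [hN, hY]; ring
    -- f(R) − f(Y) = (R − Y)[(R + Y)(k₂−ℓ) − (k₂−k₁)(t−2ℓ)] ≥ 0 for R = t − 2k₁
    have hmono : Y ^ 2 * ((k₂ : ℝ) - ((k₁ : ℝ) + a)) + ((k₂ : ℝ) - k₁) * (((k₂ : ℝ) - k₁) - Y) * (t - 2 * ((k₁ : ℝ) + a))
        ≤ (t - 2 * (k₁ : ℝ)) ^ 2 * ((k₂ : ℝ) - ((k₁ : ℝ) + a))
          + ((k₂ : ℝ) - k₁) * (((k₂ : ℝ) - k₁) - (t - 2 * (k₁ : ℝ))) * (t - 2 * ((k₁ : ℝ) + a)) := by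
      have e : (t - 2 * (k₁ : ℝ)) ^ 2 * ((k₂ : ℝ) - ((k₁ : ℝ) + a))
          + ((k₂ : ℝ) - k₁) * (((k₂ : ℝ) - k₁) - (t - 2 * (k₁ : ℝ))) * (t - 2 * ((k₁ : ℝ) + a))
          - (Y ^ 2 * ((k₂ : ℝ) - ((k₁ : ℝ) + a)) + ((k₂ : ℝ) - k₁) * (((k₂ : ℝ) - k₁) - Y) * (t - 2 * ((k₁ : ℝ) + a)))
          = ((t - 2 * (k₁ : ℝ)) - Y) * (((t - 2 * (k₁ : ℝ)) * ((k₂ : ℝ) - ((k₁ : ℝ) + a)))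
              + (Y * ((k₂ : ℝ) - ((k₁ : ℝ) + a)) - ((k₂ : ℝ) - k₁) * (t - 2 * ((k₁ : ℝ) + a)))) := by ring
      have h1 : 0 ≤ (t - 2 * (k₁ : ℝ)) * ((k₂ : ℝ) - ((k₁ : ℝ) + a)) := mul_nonneg (by linarith) hd.le
      have h2 : 0 ≤ Y * ((k₂ : ℝ) - ((k₁ : ℝ) + a)) - ((k₂ : ℝ) - k₁) * (t - 2 * ((k₁ : ℝ) + a)) := by linarith
      nlinarith [mul_nonneg (sub_nonneg.2 hYle) (add_nonneg h1 h2), e]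
    -- at Y = t − 2k₁:  (t−ℓ)(k₂−ℓ)(k₂−k₁)² − f(t−2k₁)(k₂−a) = (k₁+k₂−t)[k₁(k₂−k₁)² + a(k₂−a)(k₁+k₂−t)] ≥ 0
    have eP : (t - ((k₁ : ℝ) + a)) * ((k₂ : ℝ) - ((k₁ : ℝ) + a)) * ((k₂ : ℝ) - k₁) ^ 2
        - ((t - 2 * (k₁ : ℝ)) ^ 2 * ((k₂ : ℝ) - ((k₁ : ℝ) + a))
          + ((k₂ : ℝ) - k₁) * (((k₂ : ℝ) - k₁) - (t - 2 * (k₁ : ℝ))) * (t - 2 * ((k₁ : ℝ) + a))) * ((k₂ : ℝ) - a)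
        = ((k₁ : ℝ) + k₂ - t) * ((k₁ : ℝ) * ((k₂ : ℝ) - k₁) ^ 2 + (a : ℝ) * ((k₂ : ℝ) - a) * ((k₁ : ℝ) + k₂ - t)) := by ring
    have hka : (0 : ℝ) ≤ (k₂ : ℝ) - a := by linarith
    have hP : 0 ≤ ((k₁ : ℝ) + k₂ - t) * ((k₁ : ℝ) * ((k₂ : ℝ) - k₁) ^ 2 + (a : ℝ) * ((k₂ : ℝ) - a) * ((k₁ : ℝ) + k₂ - t)) :=
      mul_nonneg (by linarith) (add_nonneg (mul_nonneg hk₁0 (sq_nonneg _)) (mul_nonneg (mul_nonneg ha0 hka) (by linarith)))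
    -- hence N(k₂−a)(k₂−k₁)² ≤ (t−ℓ)(k₂−ℓ)(k₂−k₁)², so N(k₂−a) ≤ (t−ℓ)(k₂−ℓ)
    have hN2 : N * ((k₂ : ℝ) - a) * ((k₂ : ℝ) - k₁) ^ 2 ≤ (t - ((k₁ : ℝ) + a)) * ((k₂ : ℝ) - ((k₁ : ℝ) + a)) * ((k₂ : ℝ) - k₁) ^ 2 := by
      have h1 := mul_le_mul_of_nonneg_right hmono hka
      have e2 : N * ((k₂ : ℝ) - a) * ((k₂ : ℝ) - k₁) ^ 2 = N * ((k₂ : ℝ) - k₁) ^ 2 * ((k₂ : ℝ) - a) := by ring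
      rw [e2, eNK]
      linarith [h1, eP, hP]
    have hN1 : N * ((k₂ : ℝ) - a) ≤ (t - ((k₁ : ℝ) + a)) * ((k₂ : ℝ) - ((k₁ : ℝ) + a)) :=
      le_of_mul_le_mul_right hN2 (pow_pos hK 2)
    -- N(k₂−t+k₁) ≤ (t−ℓ)((k₂−ℓ) − N)  ⟺  N(k₂−a) ≤ (t−ℓ)(k₂−ℓ)
    rw [eDn]
    have e3 : (t - ((k₁ : ℝ) + a)) * (((k₂ : ℝ) - ((k₁ : ℝ) + a)) - N) - N * ((k₂ : ℝ) - t + k₁)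
        = (t - ((k₁ : ℝ) + a)) * ((k₂ : ℝ) - ((k₁ : ℝ) + a)) - N * ((k₂ : ℝ) - a) := by ring
    linarith [hN1, e3]

/-! ### (I_{U₁}) outside the thin regime -/

set_option maxHeartbeats 800000 in
/-- **THE KINK MEMBER (I_{U₁}) of cell P-DEAR**, from the frame plus its validity in the thin regime
`{u z < m₂' < u(z + m₁), (t−2k₁)/u < k₂ + a − t}` (hypothesis `hthin`; `u = y/(1−y)`): `U₁(z + m₁) + U_d m₁' ≤ m₂ + U₁(1−y)/y·m₂'`.
Cases: `u(z + m₁) ≤ m₂'` — census-2's `pooled_dear` and `U₁ ≥ u`; otherwise the mean-identity form (♥) with `usage_twin_gap`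
(`B₁ ≥ 0`), immediate for `B₂ ≤ 0` and for `m₂' ≤ u z`. [this work] -/
theorem kink_member_U1 (y z g S lam : ℝ) (a j k₁ k₂ : ℕ)
    (hy0 : 0 < y) (hy1 : y < 1) (hz0 : 0 ≤ z) (hz1 : z < 1) (hg0 : 0 ≤ g) (hg1 : g ≤ 1) (hyg : y ≤ (1 - z) * g)
    (hlam0 : 0 ≤ lam) (hlam1 : lam < 1) (hk₂j : k₂ ≤ j) (hyk₂ : y * (k₂ : ℝ) ≤ S)
    (hmean : (1 - z) * ((k₁ : ℝ) + ((k₂ : ℝ) - k₁) * lam) = S)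
    (hk₁low : 2 * (k₁ : ℝ) < S + (a : ℝ) * g * (1 - z)) (hPlow : 2 * ((k₁ + a : ℕ) : ℝ) < S + (a : ℝ) * g * (1 - z))
    (hk₂mid : S + (a : ℝ) * g * (1 - z) ≤ 2 * (k₂ : ℝ)) (hcomp : S + (a : ℝ) * g * (1 - z) < ((k₁ + a : ℕ) : ℝ) + k₂)
    (hc1 : S + (a : ℝ) * g * (1 - z) < (k₁ : ℝ) + k₂)
    (hdear : y * ((k₂ : ℝ) - k₁) ≤ S + (a : ℝ) * g * (1 - z) - 2 * (k₁ : ℝ))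
    (hthin : y / (1 - y) * z < (1 - z) * lam * g →
      (1 - z) * lam * g < y / (1 - y) * (z + (1 - z) * (1 - lam) * (1 - g)) →
      (S + (a : ℝ) * g * (1 - z) - 2 * (k₁ : ℝ)) * ((1 - y) / y) < (k₂ : ℝ) + a - (S + (a : ℝ) * g * (1 - z)) →
      usage y (S + (a : ℝ) * g * (1 - z)) j k₁ k₂ * (z + (1 - z) * (1 - lam) * (1 - g))
        + usage y (S + (a : ℝ) * g * (1 - z)) j (k₁ + a) k₂ * ((1 - z) * (1 - lam) * g)
      ≤ (1 - z) * lam * (1 - g) + usage y (S + (a : ℝ) * g * (1 - z)) j k₁ k₂ * ((1 - y) / y) * ((1 - z) * lam * g)) :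
    usage y (S + (a : ℝ) * g * (1 - z)) j k₁ k₂ * (z + (1 - z) * (1 - lam) * (1 - g))
        + usage y (S + (a : ℝ) * g * (1 - z)) j (k₁ + a) k₂ * ((1 - z) * (1 - lam) * g)
      ≤ (1 - z) * lam * (1 - g) + usage y (S + (a : ℝ) * g * (1 - z)) j k₁ k₂ * ((1 - y) / y) * ((1 - z) * lam * g) := by
  set t : ℝ := S + (a : ℝ) * g * (1 - z) with ht
  set U1 : ℝ := usage y t j k₁ k₂ with hU1d
  set Ud : ℝ := usage y t j (k₁ + a) k₂ with hUdd
  set A : ℝ := (1 - z) * (1 - lam) * (1 - g) with hA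
  set B : ℝ := (1 - z) * (1 - lam) * g with hB
  set C : ℝ := (1 - z) * lam * (1 - g) with hC
  set D : ℝ := (1 - z) * lam * g with hD
  have h1z : 0 < 1 - z := by linarith
  have h1y : 0 < 1 - y := by linarith
  have hu0 : 0 < y / (1 - y) := div_pos hy0 h1y
  have ha0 : (0 : ℝ) ≤ a := Nat.cast_nonneg a
  have hk₁0 : (0 : ℝ) ≤ k₁ := Nat.cast_nonneg k₁
  have hdcast : ((k₁ + a : ℕ) : ℝ) = (k₁ : ℝ) + a := by push_cast; ring
  have hA0 : 0 ≤ A := mul_nonneg (mul_nonneg h1z.le (by linarith)) (by linarith)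
  have hB0 : 0 ≤ B := mul_nonneg (mul_nonneg h1z.le (by linarith)) hg0
  have hC0 : 0 ≤ C := mul_nonneg (mul_nonneg h1z.le hlam0) (by linarith)
  have hD0 : 0 ≤ D := mul_nonneg (mul_nonneg h1z.le hlam0) hg0
  have hden : (0 : ℝ) < (k₂ : ℝ) - t + k₁ := by linarith
  -- the dear closed form of U₁ and U₁ ≥ u
  have eU1 : U1 * ((k₂ : ℝ) - t + k₁) = t - 2 * (k₁ : ℝ) := by
    rw [hU1d, usage_eq_heavy' y t j k₁ k₂ hy0 hy1 hk₂j hk₁low hc1 hdear, div_mul_eq_mul_div,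
      div_eq_iff (show (k₁ : ℝ) + k₂ - t ≠ 0 by linarith)]
    ring
  have hU1u : y / (1 - y) ≤ U1 := by
    have h1 : y / (1 - y) * ((k₂ : ℝ) - t + k₁) ≤ U1 * ((k₂ : ℝ) - t + k₁) := by
      rw [eU1, div_mul_eq_mul_div, div_le_iff₀ h1y]
      nlinarith
    exact le_of_mul_le_mul_right h1 hden
  have hU10 : 0 ≤ U1 := hu0.le.trans hU1u
  -- B₁ ≥ 0
  have hB1 : Ud * ((k₂ : ℝ) - t + k₁) ≤ t - ((k₁ : ℝ) + a) := by
    rw [← hdcast]; exact usage_twin_gap y t j a k₁ k₂ hy0 hy1 hk₂j hk₁low hPlow hk₂mid hcomp hc1 hdear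
  -- y(k₂ + a) ≤ t, i.e. u(k₂ + a − t) ≤ t
  have hW : y / (1 - y) * ((k₂ : ℝ) + a - t) ≤ t := by
    rw [div_mul_eq_mul_div, div_le_iff₀ h1y]
    have : y * (a : ℝ) ≤ (a : ℝ) * g * (1 - z) := by nlinarith
    nlinarith
  by_cases hα : y / (1 - y) * (z + A) ≤ D
  · -- pooled_dear: Ud·B + u·A + u·z ≤ C + D, then U₁ ≥ u
    have hSk₂ : S < (k₂ : ℝ) := by
      have hkr : (k₁ : ℝ) < k₂ := by linarith
      have h1 : (k₁ : ℝ) + ((k₂ : ℝ) - k₁) * lam < k₂ := by nlinarith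
      have hX0 : 0 ≤ (k₁ : ℝ) + ((k₂ : ℝ) - k₁) * lam := by nlinarith
      have h2 : (1 - z) * ((k₁ : ℝ) + ((k₂ : ℝ) - k₁) * lam) ≤ (k₁ : ℝ) + ((k₂ : ℝ) - k₁) * lam :=
        mul_le_of_le_one_left hX0 (by linarith)
      linarith
    have hpool := pooled_dear y z g S lam j k₂ a k₁ hy0 hy1 hz0 hz1.le hg0 hg1 hlam1.le hk₂j hSk₂ hyk₂ hmean hPlow hdear
    have e1 : (1 - z) * lam = C + D := by simp only [hC, hD]; ring
    rw [e1] at hpool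
    -- U1(z+A) + Ud B ≤ U1(z+A) + C + D − u(z+A) = C + D + (U1 − u)(z+A) ≤ C + D + (U1−u)·D/u = C + U1·D/u
    have h2 : (U1 - y / (1 - y)) * (z + A) ≤ (U1 - y / (1 - y)) * (D / (y / (1 - y))) :=
      mul_le_mul_of_nonneg_left (by rw [le_div_iff₀ hu0]; linarith) (by linarith)
    have e2 : (U1 - y / (1 - y)) * (D / (y / (1 - y))) = U1 * ((1 - y) / y) * D - D := by
      field_simp
    have e3 : y / (1 - y) * (z + A) = y / (1 - y) * A + y / (1 - y) * z := by ring
    have e4 : (U1 - y / (1 - y)) * (z + A) = U1 * (z + A) - y / (1 - y) * (z + A) := by ring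
    have hUdB : Ud * B = usage y t j (k₁ + a) k₂ * ((1 - z) * (1 - lam) * g) := by rw [hUdd, hB]
    linarith [hpool, h2, e2, e3, e4]
  · -- (♥): 2k₁z + k₁A + k₁C + B₁B ≥ B₂D  suffices
    have hα' : D < y / (1 - y) * (z + A) := not_le.1 hα
    -- the mean identity
    have eMI : t * z = ((k₂ : ℝ) - t) * C + ((k₂ : ℝ) + a - t) * D - (t - k₁) * A - (t - ((k₁ : ℝ) + a)) * B := by
      simp only [hA, hB, hC, hD, ht]
      linear_combination (-1 : ℝ) * hmean
    -- reduction: (I_{U₁})·(k₂−t+k₁) versus (♥)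
    have hred : 2 * (k₁ : ℝ) * z + (k₁ : ℝ) * A + (k₁ : ℝ) * C + ((t - ((k₁ : ℝ) + a)) - Ud * ((k₂ : ℝ) - t + k₁)) * B
        ≥ (((k₂ : ℝ) + a - t) - (t - 2 * (k₁ : ℝ)) * ((1 - y) / y)) * D →
        U1 * (z + A) + Ud * B ≤ C + U1 * ((1 - y) / y) * D := by
      intro hH
      have key : (C + U1 * ((1 - y) / y) * D - (U1 * (z + A) + Ud * B)) * ((k₂ : ℝ) - t + k₁)
          = 2 * (k₁ : ℝ) * z + (k₁ : ℝ) * A + (k₁ : ℝ) * C + ((t - ((k₁ : ℝ) + a)) - Ud * ((k₂ : ℝ) - t + k₁)) * B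
            - (((k₂ : ℝ) + a - t) - (t - 2 * (k₁ : ℝ)) * ((1 - y) / y)) * D := by
        have e1 : (C + U1 * ((1 - y) / y) * D - (U1 * (z + A) + Ud * B)) * ((k₂ : ℝ) - t + k₁)
            = C * ((k₂ : ℝ) - t + k₁) + U1 * ((k₂ : ℝ) - t + k₁) * (((1 - y) / y) * D)
              - U1 * ((k₂ : ℝ) - t + k₁) * (z + A) - Ud * ((k₂ : ℝ) - t + k₁) * B := by ring
        rw [e1, eU1]
        linear_combination (-1 : ℝ) * eMI
      have h1 : 0 ≤ (C + U1 * ((1 - y) / y) * D - (U1 * (z + A) + Ud * B)) * ((k₂ : ℝ) - t + k₁) := by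
        rw [key]; linarith
      have h2 := (mul_nonneg_iff_of_pos_right hden).1 h1
      linarith
    by_cases hB2 : ((k₂ : ℝ) + a - t) - (t - 2 * (k₁ : ℝ)) * ((1 - y) / y) ≤ 0
    · refine hred ?_
      have h1 : (((k₂ : ℝ) + a - t) - (t - 2 * (k₁ : ℝ)) * ((1 - y) / y)) * D ≤ 0 := mul_nonpos_of_nonpos_of_nonneg hB2 hD0
      have h2 : 0 ≤ ((t - ((k₁ : ℝ) + a)) - Ud * ((k₂ : ℝ) - t + k₁)) * B := mul_nonneg (by linarith) hB0
      have h3 : 0 ≤ (k₁ : ℝ) * z := mul_nonneg hk₁0 hz0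
      have h4 : 0 ≤ (k₁ : ℝ) * A := mul_nonneg hk₁0 hA0
      have h5 : 0 ≤ (k₁ : ℝ) * C := mul_nonneg hk₁0 hC0
      linarith
    · have hB2' : 0 < ((k₂ : ℝ) + a - t) - (t - 2 * (k₁ : ℝ)) * ((1 - y) / y) := not_le.1 hB2
      by_cases hγ : D ≤ y / (1 - y) * z
      · refine hred ?_
        -- B₂ D ≤ B₂ u z = (u(k₂+a−t) − (t−2k₁)) z ≤ 2k₁ z
        have h1 : (((k₂ : ℝ) + a - t) - (t - 2 * (k₁ : ℝ)) * ((1 - y) / y)) * D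
            ≤ (((k₂ : ℝ) + a - t) - (t - 2 * (k₁ : ℝ)) * ((1 - y) / y)) * (y / (1 - y) * z) :=
          mul_le_mul_of_nonneg_left hγ hB2'.le
        have e2 : (((k₂ : ℝ) + a - t) - (t - 2 * (k₁ : ℝ)) * ((1 - y) / y)) * (y / (1 - y) * z)
            = (y / (1 - y) * ((k₂ : ℝ) + a - t) - (t - 2 * (k₁ : ℝ))) * z := by
          field_simp
        have h3 : (y / (1 - y) * ((k₂ : ℝ) + a - t) - (t - 2 * (k₁ : ℝ))) * z ≤ 2 * (k₁ : ℝ) * z :=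
          mul_le_mul_of_nonneg_right (by linarith) hz0
        have h4 : 0 ≤ ((t - ((k₁ : ℝ) + a)) - Ud * ((k₂ : ℝ) - t + k₁)) * B := mul_nonneg (by linarith) hB0
        have h5 : 0 ≤ (k₁ : ℝ) * A := mul_nonneg hk₁0 hA0
        have h6 : 0 ≤ (k₁ : ℝ) * C := mul_nonneg hk₁0 hC0
        linarith [h1, e2, h3, h4, h5, h6]
      · exact hthin (not_le.1 hγ) hα' (by linarith)

end LawDec

end Quant

end Summit.CriticalPhenomena.PercolationContinuityZ3.Theorems
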